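import Mathlib
import HarnessLib
import Summits.NavierStokesRegularity.NavierStokesRegularity.Theorems.PoloidalWindowDoorLrcModEntireWebFunction
import Summits.NavierStokesRegularity.NavierStokesRegularity.Theorems.PoloidalWindowDoorLrcModEntireCurvedWebHuygens

/-!
# Route `PoloidalWindowDoor`, item `LrcModEntire` (stmt-NavierStokesRegularity-20428), cells (Q4-curved)/(Q4-sonic, curved) of the (TH) column —
# TOOLS FOR THE WEB FUNCTION OVER A CURVED BRANCH (class-free)

Cell ns-regularity-ideate, stub-worker seat ns-poloidal-K2-p2 g16 under the LEAD of item 20428 (ns-poloidal-K2-p3 g16);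
`--supports stmt-NavierStokesRegularity-20428 --as helper`.  Memo `Cruxes/LrcModEntire/T2B-g16-sonic.md` §3 («the Fermi-frame web package is the missing brick»).
The ¬line analogues of LEAD g16's `…Q4LineWeb` tools (which are hard-wired to the straight frame `frameCLM e`):

* `contDiffAt_criticalPoint_of_contDiffAt` — the `C^m` twin of `…WebFunction.contDiffAt_criticalPoint` (there: `C^ω`) and of port-2's
  `…RidgeWebImplicit.hasStrictFDerivAt_criticalPoint` (there: strict differentiability): the interior critical point `n₀(p)` of a family of strictly concave
  cross-sections that is `C^n` in `(p, n)` is `C^m` in `p` whenever `m ≠ 0`, `m + 1 ≤ n` (Mathlib's `ContDiffAt.implicitFunction` for `f = ∂ₙG`).  Needed because the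
  base branch `Γ` of the (Q4) package is `C^∞`, not `C^ω`;
* `contDiff_rotJ`, `contDiff_curvedSection` — the curved cross-section family `((s,z),n) ↦ F₀(Γ s + n·JΓ′ s + z·e₂)` is `C^n` for `F₀ ∈ C^n`, `Γ ∈ C^{n+1}`;
* `fderiv_curvedSection_fibre`, `fderiv_fderiv_curvedSection_fibre` — its fibre derivatives are `DF₀(x)[JΓ′ s]` and `D²F₀(x)[JΓ′ s, JΓ′ s]`;
* `fderiv_normal_eq_zero_of_strictMax` — at the unique strict maximiser `n₀ ∈ (−r,r)` of a cross-section, `∂_{JΓ′}F₀ = 0`.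

WHAT THIS IS NOT: not a claim about Navier–Stokes regularity — calculus for the hypothetical web of research cell (Q4); items 20428 / 19708 / 27893 OPEN.
-/

noncomputable section

-- the summit and its single sub-problem share the name (CONVENTIONS §1), as in every Theorems file
set_option linter.dupNamespace false

namespace Summit.NavierStokesRegularity.NavierStokesRegularity.Theorems.PoloidalWindowDoorLrcModEntireCurvedWebTools

open Set Function Filter Topology
open scoped InnerProductSpace RealInnerProductSpace ContDiff
open Summit.NavierStokesRegularity.NavierStokesRegularity.Theorems.PoloidalWindowDoorLrcModEntireRidgeWebImplicit
open Summit.NavierStokesRegularity.NavierStokesRegularity.Theorems.PoloidalWindowDoorLrcModEntireSheetFlattenTools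
open Summit.NavierStokesRegularity.NavierStokesRegularity.Theorems.PoloidalWindowDoorLrcModEntireRidgeGlobalBranchODE
open Summit.NavierStokesRegularity.NavierStokesRegularity.Theorems.PoloidalWindowDoorLrcModEntireRidgeGlobalBranchFrame
open Summit.NavierStokesRegularity.NavierStokesRegularity.Theorems.PoloidalWindowDoorLrcModEntirePlanarCurveRigidity
open Summit.NavierStokesRegularity.NavierStokesRegularity.Theorems.PoloidalWindowDoorLrcModEntireCurvedWebHuygens

/-! ### A. The critical point is `C^m` (implicit function theorem, finite or infinite smoothness) -/

section ift

variable {P : Type*} [NormedAddCommGroup P] [NormedSpace ℝ P] [CompleteSpace P]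

/-- **THE CRITICAL POINT IS `C^m`.**  `V` open; for `p ∈ V` and `|n| < r`, `G` is `C^n` at `(p, n)` and `∂ₙ∂ₙG(p,n) < 0`; `n₀ p ∈ (−r, r)` with
`∂ₙG(p, n₀ p) = 0` for `p ∈ V`; `m ≠ 0`, `m + 1 ≤ n`.  Then `n₀` is `C^m` at every `p₀ ∈ V`. -/
theorem contDiffAt_criticalPoint_of_contDiffAt {G : P × ℝ → ℝ} {V : Set P} (hV : IsOpen V) {r : ℝ} {m n : ℕ∞ω} (hm : m ≠ 0) (hmn : m + 1 ≤ n)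
    (hG : ∀ p ∈ V, ∀ n' ∈ Ioo (-r) r, ContDiffAt ℝ n G (p, n'))
    (hconc : ∀ p ∈ V, ∀ n' ∈ Ioo (-r) r, fderiv ℝ (fderiv ℝ G) (p, n') ((0 : P), (1 : ℝ)) ((0 : P), (1 : ℝ)) < 0)
    {n₀ : P → ℝ} (hn₀ : ∀ p ∈ V, n₀ p ∈ Ioo (-r) r) (hcrit : ∀ p ∈ V, fderiv ℝ G (p, n₀ p) ((0 : P), (1 : ℝ)) = 0)
    {p₀ : P} (hp₀ : p₀ ∈ V) : ContDiffAt ℝ m n₀ p₀ := by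
  set f : P × ℝ → ℝ := fun v => fderiv ℝ G v ((0 : P), (1 : ℝ)) with hf
  set u : P × ℝ := (p₀, n₀ p₀) with hu
  have hGd : ∀ p ∈ V, ∀ n' ∈ Ioo (-r) r, DifferentiableAt ℝ (fderiv ℝ G) (p, n') := fun p hp n' hn' =>
    ((hG p hp n' hn').fderiv_right hmn).differentiableAt hm
  -- `f` is `C^m` at `u`
  have hfm : ContDiffAt ℝ m f u := by
    have h := (hG p₀ hp₀ _ (hn₀ p₀ hp₀)).fderiv_right hmn
    set A : (P × ℝ →L[ℝ] ℝ) →L[ℝ] ℝ := ContinuousLinearMap.apply ℝ ℝ ((0 : P), (1 : ℝ)) with hA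
    have e : f = A ∘ fderiv ℝ G := by funext v; simp [hf, hA]
    rw [e]; exact A.contDiff.contDiffAt.comp u h
  -- the fibre derivative is the (negative) number `∂ₙ∂ₙG(u)`, so `f′ ∘ inr` is invertible
  have if₂u : (fderiv ℝ f u ∘L ContinuousLinearMap.inr ℝ P ℝ).IsInvertible := by
    set L : ℝ →L[ℝ] ℝ := fderiv ℝ f u ∘L ContinuousLinearMap.inr ℝ P ℝ with hL
    have hL1 : L 1 ≠ 0 := by
      rw [hL, ContinuousLinearMap.comp_apply, ContinuousLinearMap.inr_apply, hf, fderiv_partial_apply (hGd p₀ hp₀ _ (hn₀ p₀ hp₀))]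
      exact (hconc p₀ hp₀ _ (hn₀ p₀ hp₀)).ne
    refine ⟨ContinuousLinearEquiv.unitsEquivAut ℝ (Units.mk0 (L 1) hL1), ?_⟩
    ext
    simp
  -- the implicit function and its properties
  set ψ := hfm.implicitFunction hm if₂u with hψ
  have hψm : ContDiffAt ℝ m ψ p₀ := hfm.contDiffAt_implicitFunction hm if₂u
  have hψ0 : ψ p₀ = n₀ p₀ := hfm.implicitFunction_apply_self hm if₂u
  have hψeq : ∀ᶠ p in 𝓝 p₀, f (p, ψ p) = f u := hfm.eventually_apply_implicitFunction hm if₂u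
  have hψc : ContinuousAt ψ p₀ := hψm.continuousAt
  -- `ψ = n₀` near `p₀`: both are critical points in `(−r, r)` of a strictly concave cross-section
  have hfu : f u = 0 := hcrit p₀ hp₀
  have hev : ∀ᶠ p in 𝓝 p₀, ψ p = n₀ p := by
    have h1 : ∀ᶠ p in 𝓝 p₀, p ∈ V := hV.mem_nhds hp₀
    have h2 : ∀ᶠ p in 𝓝 p₀, ψ p ∈ Ioo (-r) r := by
      have : Tendsto ψ (𝓝 p₀) (𝓝 (n₀ p₀)) := by rw [← hψ0]; exact hψc
      exact this (isOpen_Ioo.mem_nhds (hn₀ p₀ hp₀))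
    filter_upwards [h1, h2, hψeq] with p hp hψp hq
    rw [hfu] at hq
    exact eq_of_partial_eq_zero (hGd p hp) (hconc p hp) hψp (hn₀ p hp) hq (hcrit p hp)
  exact hψm.congr_of_eventuallyEq (hev.mono fun p hp => hp.symm)

end ift

/-! ### B. The curved cross-section family and its fibre derivatives -/

section sectionFamily

variable {Γ : ℝ → EuclideanSpace ℝ (Fin 3)} {F₀ : EuclideanSpace ℝ (Fin 3) → ℝ}

/-- `rotJ` is a smooth (linear) map. -/
theorem contDiff_rotJ {n : ℕ∞ω} : ContDiff ℝ n (rotJ : EuclideanSpace ℝ (Fin 3) → EuclideanSpace ℝ (Fin 3)) := by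
  have e : (rotJ : EuclideanSpace ℝ (Fin 3) → EuclideanSpace ℝ (Fin 3)) = fun x => (-(x 1)) • e0 + (x 0) • e1 := by
    funext x; ext i; fin_cases i <;> simp [rotJ, e0, e1]
  rw [e]
  exact (((EuclideanSpace.proj (𝕜 := ℝ) (1 : Fin 3)).contDiff.neg).smul contDiff_const).add
    (((EuclideanSpace.proj (𝕜 := ℝ) (0 : Fin 3)).contDiff).smul contDiff_const)

/-- **The curved cross-section family is `C^n`** for `F₀ ∈ C^n` and `Γ ∈ C^{n+1}`:  `((s,z),m) ↦ F₀(Γ s + m·JΓ′ s + z·e₂)`. -/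
theorem contDiff_curvedSection {n : ℕ∞ω} (hF : ContDiff ℝ n F₀) (hΓ : ContDiff ℝ (n + 1) Γ) :
    ContDiff ℝ n (fun v : (ℝ × ℝ) × ℝ => F₀ (Γ v.1.1 + v.2 • rotJ (deriv Γ v.1.1) + v.1.2 • e2)) := by
  have hΓn : ContDiff ℝ n Γ := hΓ.of_le le_self_add
  have hdΓ : ContDiff ℝ n (deriv Γ) := hΓ.deriv'
  have hs : ContDiff ℝ n (fun v : (ℝ × ℝ) × ℝ => v.1.1) := contDiff_fst.comp contDiff_fst
  refine hF.comp (((hΓn.comp hs).add ?_).add ((contDiff_snd.comp contDiff_fst).smul contDiff_const))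
  exact contDiff_snd.smul (contDiff_rotJ.comp (hdΓ.comp hs))

/-- The fibre of the section family through `(p, m)` is the NORMAL LINE `m ↦ x_p + m·JΓ′(s)`: first fibre derivative `= DF₀(x)[JΓ′ s]`. -/
theorem fderiv_curvedSection_fibre (hF : ContDiff ℝ 1 F₀) (hΓ : ContDiff ℝ 2 Γ) (p : ℝ × ℝ) (m : ℝ) :
    fderiv ℝ (fun v : (ℝ × ℝ) × ℝ => F₀ (Γ v.1.1 + v.2 • rotJ (deriv Γ v.1.1) + v.1.2 • e2)) (p, m) ((0 : ℝ × ℝ), (1 : ℝ)) =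
      fderiv ℝ F₀ (Γ p.1 + m • rotJ (deriv Γ p.1) + p.2 • e2) (rotJ (deriv Γ p.1)) := by
  set S : (ℝ × ℝ) × ℝ → ℝ := fun v => F₀ (Γ v.1.1 + v.2 • rotJ (deriv Γ v.1.1) + v.1.2 • e2) with hS
  have hFd : Differentiable ℝ F₀ := hF.differentiable one_ne_zero
  have hS1 : ContDiff ℝ 1 S := contDiff_curvedSection (n := 1) hF (by simpa [show (1 : ℕ∞ω) + 1 = 2 by norm_num] using hΓ)
  have hSd : DifferentiableAt ℝ S (p, m) := (hS1.differentiable one_ne_zero) _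
  -- restrict to the fibre line
  have hι : HasDerivAt (fun m' : ℝ => ((p, m') : (ℝ × ℝ) × ℝ)) ((0 : ℝ × ℝ), (1 : ℝ)) m :=
    (hasDerivAt_const m p).prodMk (hasDerivAt_id m)
  have h1 : HasDerivAt (fun m' : ℝ => S (p, m')) (fderiv ℝ S (p, m) ((0 : ℝ × ℝ), (1 : ℝ))) m := hSd.hasFDerivAt.comp_hasDerivAt m hι
  -- the fibre is the normal line, along which `F₀` has derivative `DF₀(x)[JΓ′ s]`
  have hline : HasDerivAt (fun m' : ℝ => Γ p.1 + m' • rotJ (deriv Γ p.1) + p.2 • e2) (rotJ (deriv Γ p.1)) m := by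
    have h := (((hasDerivAt_id m).smul_const (rotJ (deriv Γ p.1))).const_add (Γ p.1)).add_const (p.2 • e2)
    simpa using h
  have h2 : HasDerivAt (fun m' : ℝ => S (p, m')) (fderiv ℝ F₀ (Γ p.1 + m • rotJ (deriv Γ p.1) + p.2 • e2) (rotJ (deriv Γ p.1))) m :=
    (hFd _).hasFDerivAt.comp_hasDerivAt m hline
  exact h1.unique h2

/-- Second fibre derivative of the section family: `D²S(p,m)[(0,1),(0,1)] = D²F₀(x)[JΓ′ s, JΓ′ s]`. -/
theorem fderiv_fderiv_curvedSection_fibre (hF : ContDiff ℝ 2 F₀) (hΓ : ContDiff ℝ 3 Γ) (p : ℝ × ℝ) (m : ℝ) :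
    fderiv ℝ (fderiv ℝ (fun v : (ℝ × ℝ) × ℝ => F₀ (Γ v.1.1 + v.2 • rotJ (deriv Γ v.1.1) + v.1.2 • e2))) (p, m)
        ((0 : ℝ × ℝ), (1 : ℝ)) ((0 : ℝ × ℝ), (1 : ℝ)) =
      fderiv ℝ (fderiv ℝ F₀) (Γ p.1 + m • rotJ (deriv Γ p.1) + p.2 • e2) (rotJ (deriv Γ p.1)) (rotJ (deriv Γ p.1)) := by
  set S : (ℝ × ℝ) × ℝ → ℝ := fun v => F₀ (Γ v.1.1 + v.2 • rotJ (deriv Γ v.1.1) + v.1.2 • e2) with hS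
  set ν : EuclideanSpace ℝ (Fin 3) := rotJ (deriv Γ p.1) with hν
  have hF1 : ContDiff ℝ 1 F₀ := hF.of_le (by norm_num)
  have hΓ2 : ContDiff ℝ 2 Γ := hΓ.of_le (by norm_num)
  have hS2 : ContDiff ℝ 2 S := contDiff_curvedSection (n := 2) hF (by simpa [show (2 : ℕ∞ω) + 1 = 3 by norm_num] using hΓ)
  have hSd2 : DifferentiableAt ℝ (fderiv ℝ S) (p, m) := ((hS2.fderiv_right (m := 1) (by norm_num)).differentiable one_ne_zero) _
  -- the first fibre partial along the fibre line is `m' ↦ DF₀(x_p + m'ν)[ν]`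
  have hfib : (fun m' : ℝ => fderiv ℝ S (p, m') ((0 : ℝ × ℝ), (1 : ℝ))) = fun m' => fderiv ℝ F₀ (Γ p.1 + m' • ν + p.2 • e2) ν :=
    funext fun m' => fderiv_curvedSection_fibre hF1 hΓ2 p m'
  -- its derivative in `m'` is `D²S[(0,1),(0,1)]` (port-2's `hasDerivAt_partial_fibre`) ...
  have h1 : HasDerivAt (fun m' : ℝ => fderiv ℝ S (p, m') ((0 : ℝ × ℝ), (1 : ℝ)))
      (fderiv ℝ (fderiv ℝ S) (p, m) ((0 : ℝ × ℝ), (1 : ℝ)) ((0 : ℝ × ℝ), (1 : ℝ))) m := hasDerivAt_partial_fibre hSd2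
  -- ... and also `D²F₀(x)[ν,ν]` along the normal line
  have hDF : ∀ y, HasFDerivAt (fderiv ℝ F₀) (fderiv ℝ (fderiv ℝ F₀) y) y := fun y =>
    (((hF.fderiv_right (m := 1) (by norm_num)).differentiable one_ne_zero) y).hasFDerivAt
  have hline : HasDerivAt (fun m' : ℝ => Γ p.1 + m' • ν + p.2 • e2) ν m := by
    have h := (((hasDerivAt_id m).smul_const ν).const_add (Γ p.1)).add_const (p.2 • e2)
    simpa using h
  have h2 : HasDerivAt (fun m' : ℝ => fderiv ℝ F₀ (Γ p.1 + m' • ν + p.2 • e2) ν)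
      (fderiv ℝ (fderiv ℝ F₀) (Γ p.1 + m • ν + p.2 • e2) ν ν) m := by
    have hc : HasDerivAt (fun m' : ℝ => fderiv ℝ F₀ (Γ p.1 + m' • ν + p.2 • e2))
        (fderiv ℝ (fderiv ℝ F₀) (Γ p.1 + m • ν + p.2 • e2) ν) m := (hDF _).comp_hasDerivAt m hline
    exact hc.clm_apply (hasDerivAt_const m ν) |>.congr_deriv (by simp)
  rw [hfib] at h1
  exact h1.unique h2

/-- **`∂_{JΓ′}F₀ = 0` at the unique strict maximiser of a cross-section** (an interior maximum). -/
theorem fderiv_normal_eq_zero_of_strictMax (hF : Differentiable ℝ F₀) {s z r Rz n₀ : ℝ}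
    (hn₀ : n₀ ∈ Ioo (-r) r) (hval : F₀ (Γ s + n₀ • rotJ (deriv Γ s) + z • e2) = Rz)
    (huniq : ∀ n ∈ Icc (-r) r, n ≠ n₀ → F₀ (Γ s + n • rotJ (deriv Γ s) + z • e2) < Rz) :
    fderiv ℝ F₀ (Γ s + n₀ • rotJ (deriv Γ s) + z • e2) (rotJ (deriv Γ s)) = 0 := by
  set g : ℝ → ℝ := fun n => F₀ (Γ s + n • rotJ (deriv Γ s) + z • e2) with hg
  have hmax : IsLocalMax g n₀ := by
    filter_upwards [isOpen_Ioo.mem_nhds hn₀] with n hn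
    by_cases hne : n = n₀
    · rw [hne]
    · have h := huniq n (Ioo_subset_Icc_self hn) hne
      simp only [hg]; rw [hval]; exact h.le
  have hline : HasDerivAt (fun n : ℝ => Γ s + n • rotJ (deriv Γ s) + z • e2) (rotJ (deriv Γ s)) n₀ := by
    have h := (((hasDerivAt_id n₀).smul_const (rotJ (deriv Γ s))).const_add (Γ s)).add_const (z • e2)
    simpa using h
  have hgd : HasDerivAt g (fderiv ℝ F₀ (Γ s + n₀ • rotJ (deriv Γ s) + z • e2) (rotJ (deriv Γ s))) n₀ :=
    (hF _).hasFDerivAt.comp_hasDerivAt n₀ hline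
  exact hmax.hasDerivAt_eq_zero hgd

end sectionFamily

end Summit.NavierStokesRegularity.NavierStokesRegularity.Theorems.PoloidalWindowDoorLrcModEntireCurvedWebTools
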